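import Summits.ABC.IUTFork.Conditional.AbcOfSGenuineKLinUniformBand
import Summits.ABC.IUTFork.Conditional.AbcOfSGenuineKTameRobustRows5
import Summits.ABC.IUTFork.Conditional.AbcOfSGenuineKTameRobustTriple
import Summits.ABC.IUTFork.Conditional.AbcOfSGenuineKChosenDepthRadRows3
import HarnessLib

/-!
# R-W table rows (block F3) DECIDED on the refuted side, UNIFORMLY IN `l`, by [LIN]-uniform BAND theorems — part 8
# (triples: 2 ^ 12 * 13 ^ 3 * 223 ^ 3 + 3 ^ 15 * 11 ^ 3 * 97 ^ 5 * 409 = 5 ^ 15 * 179 ^ 4 * 2141, 3 ^ 3 * 241 ^ 3 + 5 ^ 8 * 11 ^ 9 * 19 * 61 ^ 3 = 2 ^ 15 * 17 ^ 2 * 331 * 1061 ^ 4, 7 ^ 3 * 29 ^ 5 * 151 ^ 2 + 2 ^ 4 * 5 ^ 16 * 97 * 919 = 3 ^ 27 * 13 ^ 4)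

PROOF-ONLY file (no `def`, no new `Prop`, no instance) of the abc-iut cell (D-0079 R-W numerics crew seat abc-iut-W-num-6, gen 2; row «W:F3-LINU-BANDS»).
TAKES NO SIDE on [IUTchIII] Cor. 3.12 or on any author. ONE THEOREM PER KNOWN abc TRIPLE: this seat's band certificate form
`GenuineK.not_pilotKummerCompatHull_chosen_triple_of_linUniform_cert` (`AbcOfSGenuineKLinUniformBand`) of abc-iut-w5-d107's e-free [LIN]-uniform decider p464182 is
instantiated with ONE deciding prime `p ∉ {2,3,5}` of the triple and a short chain of bands `B` (case split on `l ≤ ⌊(p^B(p−1)−1)/30⌋`); every integer side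
condition is a closed numeral checked by `norm_num`, the band membership by `omega`. Each theorem `…_frey<a>_band {l} (hl : l.Prime) (hlo : L₀ ≤ l) (hhi : l ≤ L₁)`
decides, for EVERY prime `l` in its range (not only the tabulated `l ≤ 397` of the R-W numerics lead's WINDOW-TABLE block F3 / TE30-CENSUS) and EVERY genuine
Θ-volume datum `T` over `(ratPoint (a/c), l)`, that the hull-level clause S_H (chosen realising ideles, pinned reading — the per-datum object of the window binders
`hSHw`/`hSHwBad`) FAILS for every choice of the free context binders and Kummer datum. The `IsABCTriple` facts are the tree's (abc-iut-w5-d107 / W-ref lineages), BY NAME.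
Machine list of the (triple, l) rows: HOME/abc-iut-W-num-6/bands/BAND-ROWS.tsv. NOT claimed: admissibility / Szpiro-badness / (P6) of `(ratPoint (a/c), l)`,
non-emptiness of the datum type. HONEST SCOPE as in the parents: SHARP reading; per-label licence STRONGER than print; «refuted as typed» ≠ «refuted in print»;
nothing about the number-level Corollary; typed ≠ proved; instantiated ≠ endorsed. [cite: Mochizuki2012, IUTchIII Cor. 3.12 Step (xi-f) p. 184; IUTchIV Prop. 1.2 p. 10,
Cor. 2.2 (ii) proof p. 44] [cite: MochizukiGenEll2010, Thm. 2.1 p. 11] [claim: Mochizuki2012, status: disputed] for every IUT sentence quoted.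
-/

noncomputable section

open Set Function NumberField IsDedekindDomain

namespace Summit.ABC.IUTFork.Conditional

open Thm311 Thm311.Real Cor312 Cor312Vol Cor312Prov Literature.IUT.LogThetaLattice Literature.IUT.LogVolume
  Literature.IUT.HodgeTheaters Literature.IUT.LogVolume.ThetaData Literature.IUT.LogVolume.Cor22
open Literature.NumberTheory.NumberFields Literature.NumberTheory.GaloisRepresentations.Ultrametric
open Literature.NumberTheory.DiophantineGeometry Literature.NumberTheory.DiophantineGeometry.GenEll Summit.ABC.ABC.Theorems

/-- **R-W ROWS `pilotDataOfK:frey-99794037551104-67077806999235503464521-67077807099029541015625:l` for EVERY prime `20 ≤ l ≤ 310` with `l ≠ 97` —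
REFUTED side, unconditionally, BY ONE BAND THEOREM** (block F3 of the R-W numerics lead's WINDOW-TABLE: 54 tabulated Szpiro-bad admissible `l` of this
triple, `23 ≤ l ≤ 307`): triple `2 ^ 12 * 13 ^ 3 * 223 ^ 3 + 3 ^ 15 * 11 ^ 3 * 97 ^ 5 * 409 = 5 ^ 15 * 179 ^ 4 * 2141`; deciding prime `p = 97` (`97^5
∣ abc`, `p ∤ 30`), bands `B = 1` for `l ≤ 310` (certificate `l₀ = 20`); `l = 97` excluded (`p = l` is outside the decider): at the label `j = l⋆ =
(l−1)/2` the [LIN]-uniform test of p464182 holds throughout the band (quadratic certificate `LinUniformBand.test_of_cert`), so the hull-level clause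
S_H (chosen realising ideles, pinned reading) FAILS at every genuine Θ-volume datum over `(ratPoint (a/c), l)` for every choice of the free context
binders and Kummer datum. NOT claimed: admissibility / Szpiro-badness / (P6) / non-emptiness. [cite: Mochizuki2012, IUTchIII Cor. 3.12 Step (xi-f) p.
184; IUTchIV Prop. 1.2 p. 10] [claim: Mochizuki2012, status: disputed] -/
theorem GenuineK.not_pilotKummerCompatHull_chosen_frey99794037551104_band {l : ℕ} (hl : l.Prime) (hlo : 20 ≤ l) (hhi : l ≤ 310) (hneP : l ≠ 97)
    (T : Cor22.ThetaVolumeDatumAt (ratPoint (((2 ^ 12 * 13 ^ 3 * 223 ^ 3 : ℕ) : ℚ) / (5 ^ 15 * 179 ^ 4 * 2141 : ℕ))) l) :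
    letI := T.instFieldF; letI := T.instNumberFieldF; letI := T.instAlgebraF; letI := T.instFieldK
    letI := T.instNumberFieldK; letI := T.instAlgebraK; letI := T.instFieldFbar; letI := T.instAlgebraFbar
    letI := T.instAlgebraKFbar; letI := T.instIsElliptic
    ∀ (M : Type) [Field M] [NumberField M]
      (archPk : ∀ (j : (thetaIndex (pilotDataOfK T.D T.K)).Label) (vQ : (thetaIndex (pilotDataOfK T.D T.K)).VQ),
        Set ((logShellsDH (pilotDataOfK T.D T.K) (analyticLogv T.K)).Packet j vQ))
      (archSub : ∀ (j : (thetaIndex (pilotDataOfK T.D T.K)).Label) (v : (thetaIndex (pilotDataOfK T.D T.K)).V),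
        Set ((logShellsDH (pilotDataOfK T.D T.K) (analyticLogv T.K)).Packet j ((thetaIndex (pilotDataOfK T.D T.K)).over v)))
      (Ψ : ℤ → ∀ v : (thetaIndex (pilotDataOfK T.D T.K)).V, v ∈ (thetaIndex (pilotDataOfK T.D T.K)).Vbad →
        Set ((logShellsDH (pilotDataOfK T.D T.K) (analyticLogv T.K)).StarPacket v))
      (act : ℤ → ∀ v : (thetaIndex (pilotDataOfK T.D T.K)).V, v ∈ (thetaIndex (pilotDataOfK T.D T.K)).Vbad →
        (logShellsDH (pilotDataOfK T.D T.K) (analyticLogv T.K)).StarPacket v →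
          Module.End ℚ ((logShellsDH (pilotDataOfK T.D T.K) (analyticLogv T.K)).StarPacket v))
      (Mmod : ℤ → ∀ j : (thetaIndex (pilotDataOfK T.D T.K)).LabelStar, Set ((logShellsDH (pilotDataOfK T.D T.K) (analyticLogv T.K)).GlobalPacket j.1))
      (region : ℤ → ∀ j : (thetaIndex (pilotDataOfK T.D T.K)).LabelStar, FinDivisor M → ∀ vQ : (thetaIndex (pilotDataOfK T.D T.K)).VQ,
        Set ((logShellsDH (pilotDataOfK T.D T.K) (analyticLogv T.K)).Packet j.1 vQ))
      (frobAdm : ℤ → ℤ → ∀ (j : (thetaIndex (pilotDataOfK T.D T.K)).Label) (vQ : (thetaIndex (pilotDataOfK T.D T.K)).VQ),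
        Set ((logShellsDH (pilotDataOfK T.D T.K) (analyticLogv T.K)).Packet j vQ) → Prop)
      (frobLogvol : ℤ → ℤ → ∀ (j : (thetaIndex (pilotDataOfK T.D T.K)).Label) (vQ : (thetaIndex (pilotDataOfK T.D T.K)).VQ),
        Set ((logShellsDH (pilotDataOfK T.D T.K) (analyticLogv T.K)).Packet j vQ) → ℝ)
      (frobΨ : ℤ → ℤ → ∀ v : (thetaIndex (pilotDataOfK T.D T.K)).V, v ∈ (thetaIndex (pilotDataOfK T.D T.K)).Vbad →
        Set ((logShellsDH (pilotDataOfK T.D T.K) (analyticLogv T.K)).StarPacket v))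
      (frobMmod : ℤ → ℤ → ∀ j : (thetaIndex (pilotDataOfK T.D T.K)).LabelStar, Set ((logShellsDH (pilotDataOfK T.D T.K) (analyticLogv T.K)).GlobalPacket j.1))
      (unitImage : ℤ → ℤ → ℕ → ∀ (j : (thetaIndex (pilotDataOfK T.D T.K)).Label) (vQ : (thetaIndex (pilotDataOfK T.D T.K)).VQ),
        Set ((logShellsDH (pilotDataOfK T.D T.K) (analyticLogv T.K)).Packet j vQ))
      (ballImage : ℤ → ℤ → ∀ (j : (thetaIndex (pilotDataOfK T.D T.K)).Label) (vQ : (thetaIndex (pilotDataOfK T.D T.K)).VQ),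
        Set ((logShellsDH (pilotDataOfK T.D T.K) (analyticLogv T.K)).Packet j vQ))
      (thetaDiv : ℤ → ℤ → LgpDivisor M (thetaIndex (pilotDataOfK T.D T.K)).lstar)
      (n : ℤ) {HT : Type} {LogLink : HT → HT → Type} {IsFull : ∀ {s t : HT}, LogLink s t → Prop}
      (lat : LGPGaussianLogThetaLattice LogLink IsFull)
      {Frd : Type} {IsoF : Frd → Frd → Type} {Ob : Frd → Type} {realify : Frd → Frd} {Strip : Type}
      {IsoS : Strip → Strip → Type} {Mv : ∀ v : (thetaIndex (pilotDataOfK T.D T.K)).V, v ∈ (thetaIndex (pilotDataOfK T.D T.K)).Vbad → Type}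
      [∀ v h, Monoid (Mv v h)]
      (sig : GlobalLGPFrobenioidSignature (thetaIndex (pilotDataOfK T.D T.K)).lstar (thetaIndex (pilotDataOfK T.D T.K)).V
        (· ∈ (thetaIndex (pilotDataOfK T.D T.K)).Vbad) Frd IsoF Ob realify Strip IsoS Mv)
      (split : SplittingMonoids Mv) {ObΔ : Type} {N : ∀ v : (thetaIndex (pilotDataOfK T.D T.K)).V, v ∈ (thetaIndex (pilotDataOfK T.D T.K)).Vbad → Type}
      [∀ v h, Monoid (N v h)] (qData : QPilotData ObΔ N)
      (qK : ∀ v : (thetaIndex (pilotDataOfK T.D T.K)).V, v ∈ (thetaIndex (pilotDataOfK T.D T.K)).Vbad →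
        Set ((logShellsDH (pilotDataOfK T.D T.K) (analyticLogv T.K)).StarPacket v)),
      ¬ Cor312Vol.PilotKummerCompatHull
          (LatticeSituation.ofShells (logShellsDH (pilotDataOfK T.D T.K) (analyticLogv T.K)) M archPk archSub
            (summandPiecesPr (pilotDataOfK T.D T.K) (logvAnalytic_analyticLogv (F := T.K))).Adm
            (summandPiecesPr (pilotDataOfK T.D T.K) (logvAnalytic_analyticLogv (F := T.K))).logvol Ψ act Mmod region frobAdm frobLogvol frobΨ
            frobMmod unitImage ballImage thetaDiv)
          (settingPrVolSharp (pilotDataOfK T.D T.K) (logvAnalytic_analyticLogv (F := T.K)) M archPk archSub Ψ act Mmod region n lat sig split qData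
            (exists_realising_qIdeles_pilotDataOfK T.D).choose (exists_realising_thetaIdeles_pilotDataOfK T.D).choose
            (exists_realising_qIdeles_pilotDataOfK T.D).choose_spec.1 (exists_realising_qIdeles_pilotDataOfK T.D).choose_spec.2.1)
          (fun _ => Cor312.Setting.qRegion
            (settingPrVolSharp (pilotDataOfK T.D T.K) (logvAnalytic_analyticLogv (F := T.K)) M archPk archSub Ψ act Mmod region n lat sig split qData
              (exists_realising_qIdeles_pilotDataOfK T.D).choose (exists_realising_thetaIdeles_pilotDataOfK T.D).choose
              (exists_realising_qIdeles_pilotDataOfK T.D).choose_spec.1 (exists_realising_qIdeles_pilotDataOfK T.D).choose_spec.2.1)) qK := by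
  exact GenuineK.not_pilotKummerCompatHull_chosen_triple_of_linUniform_cert isABCTriple_frey99794037551104 T ⟨97, by norm_num⟩ (by norm_num) (by norm_num)
      (by norm_num) hneP.symm 1 (by show 30 * l < 97 ^ 1 * (97 - 1); norm_num; omega) 5 (by norm_num) (dvd_mul_of_dvd_left (dvd_mul_of_dvd_right (by norm_num) _) _) hl (by omega) 20 (by omega)
      (by norm_num) (by norm_num) (by norm_num)

/-- **R-W ROWS `pilotDataOfK:frey-377933067-3972256707877558203125-3972256707877936136192:l` for EVERY prime `12 ≤ l ≤ 443` — REFUTED side,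
unconditionally, BY ONE BAND THEOREM** (block F3 of the R-W numerics lead's WINDOW-TABLE: 73 tabulated Szpiro-bad admissible `l` of this triple, `13 ≤
l ≤ 397`): triple `3 ^ 3 * 241 ^ 3 + 5 ^ 8 * 11 ^ 9 * 19 * 61 ^ 3 = 2 ^ 15 * 17 ^ 2 * 331 * 1061 ^ 4`; deciding prime `p = 11` (`11^9 ∣ abc`, `p ∤
30`), bands `B = 2` for `l ≤ 40` (certificate `l₀ = 12`); `B = 3` for `l ≤ 443` (certificate `l₀ = 40`): at the label `j = l⋆ = (l−1)/2` the
[LIN]-uniform test of p464182 holds throughout the band (quadratic certificate `LinUniformBand.test_of_cert`), so the hull-level clause S_H (chosen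
realising ideles, pinned reading) FAILS at every genuine Θ-volume datum over `(ratPoint (a/c), l)` for every choice of the free context binders and
Kummer datum. NOT claimed: admissibility / Szpiro-badness / (P6) / non-emptiness. [cite: Mochizuki2012, IUTchIII Cor. 3.12 Step (xi-f) p. 184; IUTchIV
Prop. 1.2 p. 10] [claim: Mochizuki2012, status: disputed] -/
theorem GenuineK.not_pilotKummerCompatHull_chosen_frey377933067_band {l : ℕ} (hl : l.Prime) (hlo : 12 ≤ l) (hhi : l ≤ 443)
    (T : Cor22.ThetaVolumeDatumAt (ratPoint (((3 ^ 3 * 241 ^ 3 : ℕ) : ℚ) / (2 ^ 15 * 17 ^ 2 * 331 * 1061 ^ 4 : ℕ))) l) :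
    letI := T.instFieldF; letI := T.instNumberFieldF; letI := T.instAlgebraF; letI := T.instFieldK
    letI := T.instNumberFieldK; letI := T.instAlgebraK; letI := T.instFieldFbar; letI := T.instAlgebraFbar
    letI := T.instAlgebraKFbar; letI := T.instIsElliptic
    ∀ (M : Type) [Field M] [NumberField M]
      (archPk : ∀ (j : (thetaIndex (pilotDataOfK T.D T.K)).Label) (vQ : (thetaIndex (pilotDataOfK T.D T.K)).VQ),
        Set ((logShellsDH (pilotDataOfK T.D T.K) (analyticLogv T.K)).Packet j vQ))
      (archSub : ∀ (j : (thetaIndex (pilotDataOfK T.D T.K)).Label) (v : (thetaIndex (pilotDataOfK T.D T.K)).V),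
        Set ((logShellsDH (pilotDataOfK T.D T.K) (analyticLogv T.K)).Packet j ((thetaIndex (pilotDataOfK T.D T.K)).over v)))
      (Ψ : ℤ → ∀ v : (thetaIndex (pilotDataOfK T.D T.K)).V, v ∈ (thetaIndex (pilotDataOfK T.D T.K)).Vbad →
        Set ((logShellsDH (pilotDataOfK T.D T.K) (analyticLogv T.K)).StarPacket v))
      (act : ℤ → ∀ v : (thetaIndex (pilotDataOfK T.D T.K)).V, v ∈ (thetaIndex (pilotDataOfK T.D T.K)).Vbad →
        (logShellsDH (pilotDataOfK T.D T.K) (analyticLogv T.K)).StarPacket v →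
          Module.End ℚ ((logShellsDH (pilotDataOfK T.D T.K) (analyticLogv T.K)).StarPacket v))
      (Mmod : ℤ → ∀ j : (thetaIndex (pilotDataOfK T.D T.K)).LabelStar, Set ((logShellsDH (pilotDataOfK T.D T.K) (analyticLogv T.K)).GlobalPacket j.1))
      (region : ℤ → ∀ j : (thetaIndex (pilotDataOfK T.D T.K)).LabelStar, FinDivisor M → ∀ vQ : (thetaIndex (pilotDataOfK T.D T.K)).VQ,
        Set ((logShellsDH (pilotDataOfK T.D T.K) (analyticLogv T.K)).Packet j.1 vQ))
      (frobAdm : ℤ → ℤ → ∀ (j : (thetaIndex (pilotDataOfK T.D T.K)).Label) (vQ : (thetaIndex (pilotDataOfK T.D T.K)).VQ),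
        Set ((logShellsDH (pilotDataOfK T.D T.K) (analyticLogv T.K)).Packet j vQ) → Prop)
      (frobLogvol : ℤ → ℤ → ∀ (j : (thetaIndex (pilotDataOfK T.D T.K)).Label) (vQ : (thetaIndex (pilotDataOfK T.D T.K)).VQ),
        Set ((logShellsDH (pilotDataOfK T.D T.K) (analyticLogv T.K)).Packet j vQ) → ℝ)
      (frobΨ : ℤ → ℤ → ∀ v : (thetaIndex (pilotDataOfK T.D T.K)).V, v ∈ (thetaIndex (pilotDataOfK T.D T.K)).Vbad →
        Set ((logShellsDH (pilotDataOfK T.D T.K) (analyticLogv T.K)).StarPacket v))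
      (frobMmod : ℤ → ℤ → ∀ j : (thetaIndex (pilotDataOfK T.D T.K)).LabelStar, Set ((logShellsDH (pilotDataOfK T.D T.K) (analyticLogv T.K)).GlobalPacket j.1))
      (unitImage : ℤ → ℤ → ℕ → ∀ (j : (thetaIndex (pilotDataOfK T.D T.K)).Label) (vQ : (thetaIndex (pilotDataOfK T.D T.K)).VQ),
        Set ((logShellsDH (pilotDataOfK T.D T.K) (analyticLogv T.K)).Packet j vQ))
      (ballImage : ℤ → ℤ → ∀ (j : (thetaIndex (pilotDataOfK T.D T.K)).Label) (vQ : (thetaIndex (pilotDataOfK T.D T.K)).VQ),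
        Set ((logShellsDH (pilotDataOfK T.D T.K) (analyticLogv T.K)).Packet j vQ))
      (thetaDiv : ℤ → ℤ → LgpDivisor M (thetaIndex (pilotDataOfK T.D T.K)).lstar)
      (n : ℤ) {HT : Type} {LogLink : HT → HT → Type} {IsFull : ∀ {s t : HT}, LogLink s t → Prop}
      (lat : LGPGaussianLogThetaLattice LogLink IsFull)
      {Frd : Type} {IsoF : Frd → Frd → Type} {Ob : Frd → Type} {realify : Frd → Frd} {Strip : Type}
      {IsoS : Strip → Strip → Type} {Mv : ∀ v : (thetaIndex (pilotDataOfK T.D T.K)).V, v ∈ (thetaIndex (pilotDataOfK T.D T.K)).Vbad → Type}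
      [∀ v h, Monoid (Mv v h)]
      (sig : GlobalLGPFrobenioidSignature (thetaIndex (pilotDataOfK T.D T.K)).lstar (thetaIndex (pilotDataOfK T.D T.K)).V
        (· ∈ (thetaIndex (pilotDataOfK T.D T.K)).Vbad) Frd IsoF Ob realify Strip IsoS Mv)
      (split : SplittingMonoids Mv) {ObΔ : Type} {N : ∀ v : (thetaIndex (pilotDataOfK T.D T.K)).V, v ∈ (thetaIndex (pilotDataOfK T.D T.K)).Vbad → Type}
      [∀ v h, Monoid (N v h)] (qData : QPilotData ObΔ N)
      (qK : ∀ v : (thetaIndex (pilotDataOfK T.D T.K)).V, v ∈ (thetaIndex (pilotDataOfK T.D T.K)).Vbad →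
        Set ((logShellsDH (pilotDataOfK T.D T.K) (analyticLogv T.K)).StarPacket v)),
      ¬ Cor312Vol.PilotKummerCompatHull
          (LatticeSituation.ofShells (logShellsDH (pilotDataOfK T.D T.K) (analyticLogv T.K)) M archPk archSub
            (summandPiecesPr (pilotDataOfK T.D T.K) (logvAnalytic_analyticLogv (F := T.K))).Adm
            (summandPiecesPr (pilotDataOfK T.D T.K) (logvAnalytic_analyticLogv (F := T.K))).logvol Ψ act Mmod region frobAdm frobLogvol frobΨ
            frobMmod unitImage ballImage thetaDiv)
          (settingPrVolSharp (pilotDataOfK T.D T.K) (logvAnalytic_analyticLogv (F := T.K)) M archPk archSub Ψ act Mmod region n lat sig split qData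
            (exists_realising_qIdeles_pilotDataOfK T.D).choose (exists_realising_thetaIdeles_pilotDataOfK T.D).choose
            (exists_realising_qIdeles_pilotDataOfK T.D).choose_spec.1 (exists_realising_qIdeles_pilotDataOfK T.D).choose_spec.2.1)
          (fun _ => Cor312.Setting.qRegion
            (settingPrVolSharp (pilotDataOfK T.D T.K) (logvAnalytic_analyticLogv (F := T.K)) M archPk archSub Ψ act Mmod region n lat sig split qData
              (exists_realising_qIdeles_pilotDataOfK T.D).choose (exists_realising_thetaIdeles_pilotDataOfK T.D).choose
              (exists_realising_qIdeles_pilotDataOfK T.D).choose_spec.1 (exists_realising_qIdeles_pilotDataOfK T.D).choose_spec.2.1)) qK := by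
  have hneP : l ≠ 11 := by omega
  rcases Nat.lt_or_ge l 41 with hlt0 | hge0
  · exact GenuineK.not_pilotKummerCompatHull_chosen_triple_of_linUniform_cert isABCTriple_1061 T ⟨11, by norm_num⟩ (by norm_num) (by norm_num)
      (by norm_num) hneP.symm 2 (by show 30 * l < 11 ^ 2 * (11 - 1); norm_num; omega) 9 (by norm_num) (dvd_mul_of_dvd_left (dvd_mul_of_dvd_right (by norm_num) _) _) hl (by omega) 12 (by omega)
      (by norm_num) (by norm_num) (by norm_num)
  exact GenuineK.not_pilotKummerCompatHull_chosen_triple_of_linUniform_cert isABCTriple_1061 T ⟨11, by norm_num⟩ (by norm_num) (by norm_num)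
      (by norm_num) hneP.symm 3 (by show 30 * l < 11 ^ 3 * (11 - 1); norm_num; omega) 9 (by norm_num) (dvd_mul_of_dvd_left (dvd_mul_of_dvd_right (by norm_num) _) _) hl (by omega) 40 (by omega)
      (by norm_num) (by norm_num) (by norm_num)

/-- **R-W ROWS `pilotDataOfK:frey-160412424963707-217634277343750000-217794689768713707:l` for EVERY prime `21 ≤ l ≤ 27` — REFUTED side,
unconditionally, BY ONE BAND THEOREM** (block F3 of the R-W numerics lead's WINDOW-TABLE: 1 tabulated Szpiro-bad admissible `l` of this triple, `23 ≤
l ≤ 23`): triple `7 ^ 3 * 29 ^ 5 * 151 ^ 2 + 2 ^ 4 * 5 ^ 16 * 97 * 919 = 3 ^ 27 * 13 ^ 4`; deciding prime `p = 29` (`29^5 ∣ abc`, `p ∤ 30`), bands `B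
= 1` for `l ≤ 27` (certificate `l₀ = 21`): at the label `j = l⋆ = (l−1)/2` the [LIN]-uniform test of p464182 holds throughout the band (quadratic
certificate `LinUniformBand.test_of_cert`), so the hull-level clause S_H (chosen realising ideles, pinned reading) FAILS at every genuine Θ-volume
datum over `(ratPoint (a/c), l)` for every choice of the free context binders and Kummer datum. NOT claimed: admissibility / Szpiro-badness / (P6) /
non-emptiness. [cite: Mochizuki2012, IUTchIII Cor. 3.12 Step (xi-f) p. 184; IUTchIV Prop. 1.2 p. 10] [claim: Mochizuki2012, status: disputed] -/
theorem GenuineK.not_pilotKummerCompatHull_chosen_frey160412424963707_band {l : ℕ} (hl : l.Prime) (hlo : 21 ≤ l) (hhi : l ≤ 27)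
    (T : Cor22.ThetaVolumeDatumAt (ratPoint (((7 ^ 3 * 29 ^ 5 * 151 ^ 2 : ℕ) : ℚ) / (3 ^ 27 * 13 ^ 4 : ℕ))) l) :
    letI := T.instFieldF; letI := T.instNumberFieldF; letI := T.instAlgebraF; letI := T.instFieldK
    letI := T.instNumberFieldK; letI := T.instAlgebraK; letI := T.instFieldFbar; letI := T.instAlgebraFbar
    letI := T.instAlgebraKFbar; letI := T.instIsElliptic
    ∀ (M : Type) [Field M] [NumberField M]
      (archPk : ∀ (j : (thetaIndex (pilotDataOfK T.D T.K)).Label) (vQ : (thetaIndex (pilotDataOfK T.D T.K)).VQ),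
        Set ((logShellsDH (pilotDataOfK T.D T.K) (analyticLogv T.K)).Packet j vQ))
      (archSub : ∀ (j : (thetaIndex (pilotDataOfK T.D T.K)).Label) (v : (thetaIndex (pilotDataOfK T.D T.K)).V),
        Set ((logShellsDH (pilotDataOfK T.D T.K) (analyticLogv T.K)).Packet j ((thetaIndex (pilotDataOfK T.D T.K)).over v)))
      (Ψ : ℤ → ∀ v : (thetaIndex (pilotDataOfK T.D T.K)).V, v ∈ (thetaIndex (pilotDataOfK T.D T.K)).Vbad →
        Set ((logShellsDH (pilotDataOfK T.D T.K) (analyticLogv T.K)).StarPacket v))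
      (act : ℤ → ∀ v : (thetaIndex (pilotDataOfK T.D T.K)).V, v ∈ (thetaIndex (pilotDataOfK T.D T.K)).Vbad →
        (logShellsDH (pilotDataOfK T.D T.K) (analyticLogv T.K)).StarPacket v →
          Module.End ℚ ((logShellsDH (pilotDataOfK T.D T.K) (analyticLogv T.K)).StarPacket v))
      (Mmod : ℤ → ∀ j : (thetaIndex (pilotDataOfK T.D T.K)).LabelStar, Set ((logShellsDH (pilotDataOfK T.D T.K) (analyticLogv T.K)).GlobalPacket j.1))
      (region : ℤ → ∀ j : (thetaIndex (pilotDataOfK T.D T.K)).LabelStar, FinDivisor M → ∀ vQ : (thetaIndex (pilotDataOfK T.D T.K)).VQ,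
        Set ((logShellsDH (pilotDataOfK T.D T.K) (analyticLogv T.K)).Packet j.1 vQ))
      (frobAdm : ℤ → ℤ → ∀ (j : (thetaIndex (pilotDataOfK T.D T.K)).Label) (vQ : (thetaIndex (pilotDataOfK T.D T.K)).VQ),
        Set ((logShellsDH (pilotDataOfK T.D T.K) (analyticLogv T.K)).Packet j vQ) → Prop)
      (frobLogvol : ℤ → ℤ → ∀ (j : (thetaIndex (pilotDataOfK T.D T.K)).Label) (vQ : (thetaIndex (pilotDataOfK T.D T.K)).VQ),
        Set ((logShellsDH (pilotDataOfK T.D T.K) (analyticLogv T.K)).Packet j vQ) → ℝ)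
      (frobΨ : ℤ → ℤ → ∀ v : (thetaIndex (pilotDataOfK T.D T.K)).V, v ∈ (thetaIndex (pilotDataOfK T.D T.K)).Vbad →
        Set ((logShellsDH (pilotDataOfK T.D T.K) (analyticLogv T.K)).StarPacket v))
      (frobMmod : ℤ → ℤ → ∀ j : (thetaIndex (pilotDataOfK T.D T.K)).LabelStar, Set ((logShellsDH (pilotDataOfK T.D T.K) (analyticLogv T.K)).GlobalPacket j.1))
      (unitImage : ℤ → ℤ → ℕ → ∀ (j : (thetaIndex (pilotDataOfK T.D T.K)).Label) (vQ : (thetaIndex (pilotDataOfK T.D T.K)).VQ),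
        Set ((logShellsDH (pilotDataOfK T.D T.K) (analyticLogv T.K)).Packet j vQ))
      (ballImage : ℤ → ℤ → ∀ (j : (thetaIndex (pilotDataOfK T.D T.K)).Label) (vQ : (thetaIndex (pilotDataOfK T.D T.K)).VQ),
        Set ((logShellsDH (pilotDataOfK T.D T.K) (analyticLogv T.K)).Packet j vQ))
      (thetaDiv : ℤ → ℤ → LgpDivisor M (thetaIndex (pilotDataOfK T.D T.K)).lstar)
      (n : ℤ) {HT : Type} {LogLink : HT → HT → Type} {IsFull : ∀ {s t : HT}, LogLink s t → Prop}
      (lat : LGPGaussianLogThetaLattice LogLink IsFull)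
      {Frd : Type} {IsoF : Frd → Frd → Type} {Ob : Frd → Type} {realify : Frd → Frd} {Strip : Type}
      {IsoS : Strip → Strip → Type} {Mv : ∀ v : (thetaIndex (pilotDataOfK T.D T.K)).V, v ∈ (thetaIndex (pilotDataOfK T.D T.K)).Vbad → Type}
      [∀ v h, Monoid (Mv v h)]
      (sig : GlobalLGPFrobenioidSignature (thetaIndex (pilotDataOfK T.D T.K)).lstar (thetaIndex (pilotDataOfK T.D T.K)).V
        (· ∈ (thetaIndex (pilotDataOfK T.D T.K)).Vbad) Frd IsoF Ob realify Strip IsoS Mv)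
      (split : SplittingMonoids Mv) {ObΔ : Type} {N : ∀ v : (thetaIndex (pilotDataOfK T.D T.K)).V, v ∈ (thetaIndex (pilotDataOfK T.D T.K)).Vbad → Type}
      [∀ v h, Monoid (N v h)] (qData : QPilotData ObΔ N)
      (qK : ∀ v : (thetaIndex (pilotDataOfK T.D T.K)).V, v ∈ (thetaIndex (pilotDataOfK T.D T.K)).Vbad →
        Set ((logShellsDH (pilotDataOfK T.D T.K) (analyticLogv T.K)).StarPacket v)),
      ¬ Cor312Vol.PilotKummerCompatHull
          (LatticeSituation.ofShells (logShellsDH (pilotDataOfK T.D T.K) (analyticLogv T.K)) M archPk archSub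
            (summandPiecesPr (pilotDataOfK T.D T.K) (logvAnalytic_analyticLogv (F := T.K))).Adm
            (summandPiecesPr (pilotDataOfK T.D T.K) (logvAnalytic_analyticLogv (F := T.K))).logvol Ψ act Mmod region frobAdm frobLogvol frobΨ
            frobMmod unitImage ballImage thetaDiv)
          (settingPrVolSharp (pilotDataOfK T.D T.K) (logvAnalytic_analyticLogv (F := T.K)) M archPk archSub Ψ act Mmod region n lat sig split qData
            (exists_realising_qIdeles_pilotDataOfK T.D).choose (exists_realising_thetaIdeles_pilotDataOfK T.D).choose
            (exists_realising_qIdeles_pilotDataOfK T.D).choose_spec.1 (exists_realising_qIdeles_pilotDataOfK T.D).choose_spec.2.1)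
          (fun _ => Cor312.Setting.qRegion
            (settingPrVolSharp (pilotDataOfK T.D T.K) (logvAnalytic_analyticLogv (F := T.K)) M archPk archSub Ψ act Mmod region n lat sig split qData
              (exists_realising_qIdeles_pilotDataOfK T.D).choose (exists_realising_thetaIdeles_pilotDataOfK T.D).choose
              (exists_realising_qIdeles_pilotDataOfK T.D).choose_spec.1 (exists_realising_qIdeles_pilotDataOfK T.D).choose_spec.2.1)) qK := by
  have hneP : l ≠ 29 := by omega
  exact GenuineK.not_pilotKummerCompatHull_chosen_triple_of_linUniform_cert isABCTriple_frey160412424963707 T ⟨29, by norm_num⟩ (by norm_num) (by norm_num)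
      (by norm_num) hneP.symm 1 (by show 30 * l < 29 ^ 1 * (29 - 1); norm_num; omega) 5 (by norm_num) (dvd_mul_of_dvd_left (dvd_mul_of_dvd_left (by norm_num) _) _) hl (by omega) 21 (by omega)
      (by norm_num) (by norm_num) (by norm_num)

end Summit.ABC.IUTFork.Conditional

end
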